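import Literature.Combinatorics.SimpleGraph.MatchingMinorBicontraction
import Literature.Combinatorics.SimpleGraph.MatchingMinorIsomorphism
import Literature.Computability.AlgebraicComplexity.DeterminantalComplexityProofs
import HarnessLib

/-!
# Matching minors are Valiant projections; `dc (PM)` is matching-minor monotone

Topic `Combinatorics/SimpleGraph`; the assembly of `MatchingMinorProjection.lean`,
`MatchingMinorBicontraction.lean`, `MatchingMinorIsomorphism.lean` (definition item
`defn-IsMatchingMinor` of route `ValiantsHypothesis/PolyaContinued`, wanted API (i); card
`polya-continued-matching-minor-dc`, S1: "dc is a matching-minor-monotone graph parameter").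

* `BicontractionStep.isProjection_perfectMatchingPoly`,
  `Bicontracts.isProjection_perfectMatchingPoly`: a (sequence of) bicontraction(s) up to
  isomorphism makes `PM` a projection (isomorphism
  invariance ∘ normal-position bicontraction ∘ isomorphism invariance, chained by
  `IsProjection.trans_holds`);
* `IsMatchingMinor.isProjection_perfectMatchingPoly`: **if `H` is a matching minor of `G` then
  `PM_H` is a Valiant projection of `PM_G`** (central subgraph, then bicontractions);
* `IsMatchingMinor.determinantalComplexity_le`: hence **`dc (PM_H) ≤ dc (PM_G)`** over any
  commutative ring, by the discharged Literature fact
  `determinantalComplexity_le_of_isProjection_holds` (Bürgisser 2000, §2.5); with the tree's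
  `perfectMatchingPoly_univ` (`PM_{K_{n,n}} = perPoly (Fin n) k` by `rfl`) this reads
  `dc (per_m) ≤ dc (PM_G)` whenever `K_{m,m}` is a matching minor of `G`
  (`IsMatchingMinor.determinantalComplexity_perPoly_le`).

* `IsMatchingMinor.hasPerfectMatching`: a matching minor with a perfect matching forces a perfect
  matching of `G` (`PM_H = PM_G (a)` and Edmonds' `PM ≠ 0 ↔` perfect matching, over `ℚ`).

All statements are over an arbitrary commutative (semi)ring of coefficients `k`; the route uses
`k = ℂ`, where `perfectMatchingPoly E ℂ` is by `rfl` the inlined `(Matrix.of …).permanent`.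

## References

* N. Robertson, P. D. Seymour, R. Thomas, *Permanents, Pfaffian orientations, and even directed
  circuits*, Ann. of Math. 150 (1999) 929–975, §4 (weak containment).
  [RobertsonSeymourThomas1999]
* L. G. Valiant, *Completeness classes in algebra*, STOC 1979 (projections). [Valiant1979]
* P. Bürgisser, *Completeness and Reduction in Algebraic Complexity Theory*, Springer 2000, §2.5
  (`dc` is projection-monotone). [Burgisser2000]
-/

namespace Literature.Combinatorics.SimpleGraph

open MvPolynomial Literature.Computability.AlgebraicComplexity

section Monotone

variable {k : Type*} [CommSemiring k]

/-- **One bicontraction step is a projection**: if `G'` is (up to isomorphism on both sides) the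
normal-position bicontraction of `G`, then `PM_{G'}` is a projection of `PM_G`. [folklore] -/
theorem BicontractionStep.isProjection_perfectMatchingPoly {m : ℕ}
    {G : Finset (Fin (m + 2) × Fin (m + 2))} {G' : Finset (Fin (m + 1) × Fin (m + 1))}
    (h : BicontractionStep G G') :
    IsProjection (perfectMatchingPoly G' k) (perfectMatchingPoly G k) := by
  obtain ⟨G₀, h₁, h₂, h₃⟩ := h
  exact IsProjection.trans_holds
    (IsProjection.trans_holds h₃.isProjection_perfectMatchingPoly
      (isProjection_perfectMatchingPoly_bicontractRowZero h₂))
    h₁.isProjection_perfectMatchingPoly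

/-- **A sequence of bicontractions is a projection**: if a graph isomorphic to `H` is obtained
from `G` by bicontractions (`Bicontracts G H`), then `PM_H` is a projection of `PM_G`.
[folklore] -/
theorem Bicontracts.isProjection_perfectMatchingPoly {n m : ℕ} {G : Finset (Fin n × Fin n)}
    {H : Finset (Fin m × Fin m)} (h : Bicontracts G H) :
    IsProjection (perfectMatchingPoly H k) (perfectMatchingPoly G k) := by
  induction h with
  | of_isIsomorphic hiso => exact hiso.isProjection_perfectMatchingPoly
  | step hstep _ ih => exact IsProjection.trans_holds ih hstep.isProjection_perfectMatchingPoly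

/-- **Matching minors are Valiant projections.** If `H` is a matching minor of `G` (`H` is weakly
contained in `G`: a central subgraph of `G` bicontracts to a graph isomorphic to `H`;
Robertson–Seymour–Thomas 1999, §4), then the perfect-matching polynomial `PM_H` is a projection
of `PM_G`: each operation — edge deletion / passage to a central (conformal) subgraph,
bicontraction after deleting the edges from one neighbour to the common neighbours, isomorphism —
is a substitution of variables and constants `0, 1`. [folklore] -/
theorem IsMatchingMinor.isProjection_perfectMatchingPoly {m n : ℕ} {H : Finset (Fin m × Fin m)}
    {G : Finset (Fin n × Fin n)} (h : IsMatchingMinor H G) :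
    IsProjection (perfectMatchingPoly H k) (perfectMatchingPoly G k) := by
  obtain ⟨l, K, hK, hB⟩ := h
  exact IsProjection.trans_holds hB.isProjection_perfectMatchingPoly
    hK.isProjection_perfectMatchingPoly

end Monotone

section DC

variable {k : Type*} [CommRing k]

/-- **`dc (PM)` is matching-minor monotone**: if `H` is a matching minor of `G` then
`dc (PM_H) ≤ dc (PM_G)` (determinantal complexity over any commutative ring `k`), since `PM_H` is
a projection of `PM_G` (`IsMatchingMinor.isProjection_perfectMatchingPoly`) and `dc` is monotone
under projections (`determinantalComplexity_le_of_isProjection_holds`, Bürgisser 2000, §2.5).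
In particular `dc (per_m) = dc (PM_{K_{m,m}}) ≤ dc (PM_G)` whenever `K_{m,m}` is a matching minor
of `G`. [folklore] -/
theorem IsMatchingMinor.determinantalComplexity_le {m n : ℕ} {H : Finset (Fin m × Fin m)}
    {G : Finset (Fin n × Fin n)} (h : IsMatchingMinor H G) :
    determinantalComplexity (perfectMatchingPoly H k) ≤
      determinantalComplexity (perfectMatchingPoly G k) :=
  determinantalComplexity_le_of_isProjection_holds h.isProjection_perfectMatchingPoly

/-- The same for a single bicontraction sequence (no central subgraph taken). [folklore] -/
theorem Bicontracts.determinantalComplexity_le {n m : ℕ} {G : Finset (Fin n × Fin n)}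
    {H : Finset (Fin m × Fin m)} (h : Bicontracts G H) :
    determinantalComplexity (perfectMatchingPoly H k) ≤
      determinantalComplexity (perfectMatchingPoly G k) :=
  determinantalComplexity_le_of_isProjection_holds h.isProjection_perfectMatchingPoly

/-- The same for a central (conformal) subgraph. [folklore] -/
theorem IsCentralSubgraph.determinantalComplexity_le {l n : ℕ} {K : Finset (Fin l × Fin l)}
    {G : Finset (Fin n × Fin n)} (h : IsCentralSubgraph K G) :
    determinantalComplexity (perfectMatchingPoly K k) ≤
      determinantalComplexity (perfectMatchingPoly G k) :=
  determinantalComplexity_le_of_isProjection_holds h.isProjection_perfectMatchingPoly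

/-- **`dc (per_m) ≤ dc (PM_G)` whenever `K_{m,m}` is a matching minor of `G`** (the form used by
sparse-universality statements "`K_{m,m}` is a matching minor of `V_{poly(m)}`"). [folklore] -/
theorem IsMatchingMinor.determinantalComplexity_perPoly_le {m n : ℕ} {G : Finset (Fin n × Fin n)}
    (h : IsMatchingMinor (Finset.univ : Finset (Fin m × Fin m)) G) :
    determinantalComplexity (perPoly (Fin m) k) ≤
      determinantalComplexity (perfectMatchingPoly G k) := by
  have hu : perfectMatchingPoly (Finset.univ : Finset (Fin m × Fin m)) k = perPoly (Fin m) k :=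
    perfectMatchingPoly_univ k
  rw [← hu]
  exact h.determinantalComplexity_le

/-- Worked example: `dc (PM_{K_{2,2}}) ≤ dc (PM_{C₆})` (`K_{2,2}` is a matching minor of the
hexagon, `isMatchingMinor_K22_hexagon`). [folklore] -/
example : determinantalComplexity (perfectMatchingPoly completeBipartiteTwo k) ≤
    determinantalComplexity (perfectMatchingPoly hexagon k) :=
  isMatchingMinor_K22_hexagon.determinantalComplexity_le

end DC

/-! ### Matching minors reflect perfect matchings -/

section PerfectMatching

/-- **If a matching minor `H` of `G` has a perfect matching, so does `G`** — read off the
projection: `PM_H = PM_G (a)`, and by Edmonds' theorem in permanent form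
(`perfectMatchingPoly_ne_zero_iff`, here over `ℚ`) `PM ≠ 0` iff a perfect matching exists.
(Combinatorially: perfect matchings extend along central subgraphs by `τ` and lift along
bicontractions.) [folklore] -/
theorem IsMatchingMinor.hasPerfectMatching {m n : ℕ} {H : Finset (Fin m × Fin m)}
    {G : Finset (Fin n × Fin n)} (h : IsMatchingMinor H G) (hH : HasPerfectMatching H) :
    HasPerfectMatching G := by
  obtain ⟨a, -, ha⟩ := h.isProjection_perfectMatchingPoly (k := ℚ)
  by_contra hG
  have hG0 : perfectMatchingPoly G ℚ = 0 :=
    not_ne_iff.1 fun hne => hG (perfectMatchingPoly_ne_zero_iff.1 hne)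
  exact perfectMatchingPoly_ne_zero_iff.2 hH (by rw [ha, hG0, map_zero])

/-- Contrapositive: a graph without perfect matchings has no matching minor possessing a perfect
matching. [folklore] -/
theorem not_isMatchingMinor_of_not_hasPerfectMatching {m n : ℕ} {H : Finset (Fin m × Fin m)}
    {G : Finset (Fin n × Fin n)} (hG : ¬ HasPerfectMatching G) (hH : HasPerfectMatching H) :
    ¬ IsMatchingMinor H G :=
  fun h => hG (h.hasPerfectMatching hH)

/-- `K_{m,m}` has a perfect matching (the identity). [folklore] -/
theorem hasPerfectMatching_univ (m : ℕ) :
    HasPerfectMatching (Finset.univ : Finset (Fin m × Fin m)) :=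
  ⟨1, fun _ => Finset.mem_univ _⟩

/-- In particular **a graph without perfect matchings has no `K_{m,m}` matching minor** (e.g. no
`K_{3,3}` matching minor — consistent with Little's theorem, such graphs being Pfaffian).
[folklore] -/
theorem not_isMatchingMinor_univ_of_not_hasPerfectMatching {m n : ℕ}
    {G : Finset (Fin n × Fin n)} (hG : ¬ HasPerfectMatching G) :
    ¬ IsMatchingMinor (Finset.univ : Finset (Fin m × Fin m)) G :=
  not_isMatchingMinor_of_not_hasPerfectMatching hG (hasPerfectMatching_univ m)

end PerfectMatching

end Literature.Combinatorics.SimpleGraph
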